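import Summits.QuantumFields.YangMills.Theorems.VirialFluxGapScalingTauberRobust
import Summits.QuantumFields.YangMills.Theorems.VirialFluxGapPeriodicVolumeFloor
import Summits.QuantumFields.YangMills.Theorems.VirialFluxGapPeriodicSoftnessOfVolumeScaling
import HarnessLib

/-!
# Route `VirialFluxGap` (YangMills): `PeriodicSoftness` ⇐ the ROBUST one-sided volume scaling law of the toron valley

Third reduction of the deciding crux ⟨stmt-QuantumFields-24141⟩ `VirialFluxGap.PeriodicSoftness` on the volume route, for the law an EXPLICIT
quasi-homogeneous contraction map delivers (w3 g58's design note; ✓`ScalingTauber.scalingTauber_robust`):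

  ROBUST-SCALING: `∃ c ∈ (0,1], K > 0, p ≥ 0, L₀: ∀ L ≥ L₀, ∀ t ∈ (0,(KL^p)⁻¹], ∀ θ ∈ (0,1]:
                   (1 − c/(40L⁴)) · θ^{9L⁴ − c} · μ_L{F₀ ≤ t} ≤ μ_L{F₀ ≤ θ·t}`

(`F₀ = RingDeficit.ringDeficit L 0`, `μ_L = RingDeficit.ringMeasure L`; any defect `η_L ≤ c/(40L⁴)` implies it, and `η_L = poly(L)·t₀^{1/4}` is made
that small by the choice of the polynomial scale `t₀ = (KL^p)⁻¹`).  ★★ `periodicSoftness_of_robustScaling : ROBUST-SCALING → PeriodicSoftness`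
(softness delivered `c/2`; window `a = 1/(4(p+10))`): ✓`scalingTauber_robust` at `α = 9L⁴ − c`, `η = c/(40L⁴)` (so `η(1+α)/(1−η) ≤ 10c/39`),
`ε = c/6`, floor `m₁ = exp(−150L⁵(1 + log(K′L^p)))` (w3 g58's ✓`VolumeFloor.exp_le_ringMeasure_real_deficit_le`), threshold by
✓`VolumeScaling.window_threshold` / ✓`threshold_of_window` at `c′ = c/4`, then ✓`RingDeficit.deficitFormZero`.

HONEST FRAMING: a REDUCTION — ROBUST-SCALING is NOT proved; ⟨24141⟩, the route VirialFluxGap (DRAFT) and every summit statement stay OPEN; the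
Yang–Mills mass gap is NOT proved.  THEOREMS ONLY (0 `def`, 0 `sorry`), standard axioms.  Width seat `ym-line-sfw-p2-w2` g51 (cell ym-idea-1,
free hands), `--supports stmt-QuantumFields-24141`.  References: [cite: Luscher1983, §2]; [cite: MontvayMunster1994, (3.145)]; [cite: Griffiths1964].
-/

set_option autoImplicit false

noncomputable section

open MeasureTheory Set Filter Real
open scoped Topology
open Summit.QuantumFields.YangMills.Theorems.VirialFluxGap.ScalingTauber
open Summit.QuantumFields.YangMills.Theorems.VirialFluxGap.RingDeficit
open Summit.QuantumFields.YangMills.Theorems.VirialFluxGap.VolumeFloor (exp_le_ringMeasure_real_deficit_le)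

namespace Summit.QuantumFields.YangMills.Theorems.VirialFluxGap.VolumeScaling
set_option maxHeartbeats 400000 in
/-- ★★ **`PeriodicSoftness` from the ROBUST volume scaling law of the toron valley**: if for some `c ∈ (0,1]` the sublevel volumes of the zero-flux
ring deficit satisfy `(1 − c/(40L⁴))·θ^{9L⁴−c}·μ_L{F₀ ≤ t} ≤ μ_L{F₀ ≤ θt}` (`0 < θ ≤ 1`, `0 < t ≤ (KL^p)⁻¹`, `L ≥ L₀`), then the route decl
`VirialFluxGap.PeriodicSoftness` holds (softness `c/2`).  A REDUCTION: the hypothesis is not proved here; no crux / rung / summit is proved;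
the YM mass gap is NOT proved. [cite: Griffiths1964] [cite: MontvayMunster1994, (3.145)] -/
theorem periodicSoftness_of_robustScaling
    (hscal : ∃ c : ℝ, 0 < c ∧ c ≤ 1 ∧ ∃ K : ℝ, 0 < K ∧ ∃ p : ℝ, 0 ≤ p ∧ ∃ L₀ : ℕ, ∀ (L : ℕ) [NeZero L], L₀ ≤ L →
      ∀ t : ℝ, 0 < t → t ≤ (K * (L : ℝ) ^ p)⁻¹ → ∀ θ : ℝ, 0 < θ → θ ≤ 1 →
        (1 - c / (40 * (L : ℝ) ^ 4)) * (θ ^ (9 * (L : ℝ) ^ 4 - c) * (ringMeasure L).real {P | ringDeficit L (fun _ => false) P ≤ t}) ≤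
          (ringMeasure L).real {P | ringDeficit L (fun _ => false) P ≤ θ * t}) :
    Summit.QuantumFields.YangMills.Theses.VirialFluxGap.PeriodicSoftness := by
  obtain ⟨c, hc, hc1, K, hK, p, hp, L₂, hsc⟩ := hscal
  set K' : ℝ := max K 1 with hK'
  have hK'1 : 1 ≤ K' := le_max_right _ _
  have hK'K : K ≤ K' := le_max_left _ _
  have hK'0 : 0 < K' := by linarith
  -- window at `c' = c/4`, floor exponent `A = 150`, `r = 5`
  have hc4 : 0 < c / 4 := by positivity
  have hc41 : c / 4 ≤ 1 := by linarith
  obtain ⟨a, ha0, β₀, hwin⟩ := window_threshold (A := 150) (p := p) (r := 5) hK'1 (by norm_num) hp (by norm_num) hc4 hc41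
  refine ⟨a, ha0, c / 2, by positivity, β₀, max L₂ 1, ?_⟩
  intro β hβ L _ hL hLβ
  have hL₂ : L₂ ≤ L := le_trans (le_max_left _ _) hL
  have hL1 : 1 ≤ L := le_trans (le_max_right _ _) hL
  obtain ⟨hβ2, hT⟩ := hwin β hβ L hL1 hLβ
  have hβ0 : 0 < β := by linarith
  have hβ1 : 1 ≤ β := by linarith
  have hℓ1 : (1 : ℝ) ≤ L := by exact_mod_cast hL1
  have hℓ0 : (0 : ℝ) < L := by linarith
  have hL4 : 1 ≤ (L : ℝ) ^ 4 := one_le_pow₀ hℓ1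
  have hR1 : 1 ≤ (L : ℝ) ^ p := Real.one_le_rpow hℓ1 hp
  have hκ1 : 1 ≤ K' * (L : ℝ) ^ p := one_le_mul_of_one_le_of_one_le hK'1 hR1
  have hκ0 : 0 < K' * (L : ℝ) ^ p := by linarith
  -- the data of `scalingTauber_robust`
  set t₀ : ℝ := (K' * (L : ℝ) ^ p)⁻¹ with ht₀
  have ht₀0 : 0 < t₀ := inv_pos.mpr hκ0
  have ht₀1 : t₀ ≤ 1 := inv_le_one_of_one_le₀ hκ1
  have ht₀K : t₀ ≤ (K * (L : ℝ) ^ p)⁻¹ := by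
    rw [ht₀]
    exact inv_anti₀ (by positivity) (mul_le_mul_of_nonneg_right hK'K (by positivity))
  set α : ℝ := 9 * (L : ℝ) ^ 4 - c with hα
  have hα1 : 1 ≤ α := by rw [hα]; linarith
  set η : ℝ := c / (40 * (L : ℝ) ^ 4) with hη
  have hη0 : 0 ≤ η := by positivity
  have hη40 : η ≤ 1 / 40 := by
    rw [hη, div_le_div_iff₀ (by positivity) (by norm_num)]; nlinarith
  have hη1 : η < 1 := by linarith
  set B : ℝ := 150 * (L : ℝ) ^ (5 : ℝ) * (1 + Real.log (K' * (L : ℝ) ^ p)) with hB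
  set m₁ : ℝ := Real.exp (-B) with hm₁
  have hm₁0 : 0 < m₁ := Real.exp_pos _
  set X : ℝ := β * t₀ with hX
  -- `X = β / (K'L^p)`, `3 ≤ X ≤ β`
  have hXge : 10 * (L : ℝ) ^ 4 * Real.log β + 3 + Real.log (2 / (c / 4)) + B ≤ X := by
    rw [hX, ht₀, ← div_eq_mul_inv, le_div_iff₀ hκ0]
    calc (10 * (L : ℝ) ^ 4 * Real.log β + 3 + Real.log (2 / (c / 4)) + B) * (K' * (L : ℝ) ^ p)
        = K' * (L : ℝ) ^ p * (10 * (L : ℝ) ^ 4 * Real.log β + 3 + Real.log (2 / (c / 4)) +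
            150 * (L : ℝ) ^ (5 : ℝ) * (1 + Real.log (K' * (L : ℝ) ^ p))) := by rw [hB]; ring
      _ ≤ β := hT
  have hlogβ : 0 ≤ Real.log β := Real.log_nonneg hβ1
  have hB0 : 0 ≤ B := by
    have : 0 ≤ Real.log (K' * (L : ℝ) ^ p) := Real.log_nonneg hκ1
    positivity
  have hlog2c : 0 ≤ Real.log (2 / (c / 4)) := Real.log_nonneg (by rw [le_div_iff₀ hc4]; linarith)
  have hX3 : 3 ≤ X := by
    have : 0 ≤ 10 * (L : ℝ) ^ 4 * Real.log β := by positivity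
    linarith
  have hXβ : X ≤ β := by rw [hX]; exact mul_le_of_le_one_right hβ0.le ht₀1
  have hβt : 2 ≤ β * t₀ := by rw [← hX]; linarith
  -- the threshold: `(X+1)X^α e^{2−X} ≤ (c/8)·m₁ ≤ (c/6)(1−η)m₁`
  have hthr0 : (β * t₀ + 1) * (β * t₀) ^ α * Real.exp (2 - β * t₀) ≤ (c / 4) / 2 * m₁ := by
    rw [← hX, hm₁]
    exact threshold_of_window (P := 10 * (L : ℝ) ^ 4) hX3 hXβ (by linarith) (by rw [hα]; linarith) hc4 hXge
  have hthr : (β * t₀ + 1) * (β * t₀) ^ α * Real.exp (2 - β * t₀) ≤ c / 6 * ((1 - η) * m₁) := by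
    refine hthr0.trans ?_
    have : (c / 4) / 2 * m₁ ≤ c / 6 * ((1 - 1 / 40) * m₁) := by nlinarith
    refine this.trans (mul_le_mul_of_nonneg_left (mul_le_mul_of_nonneg_right (by linarith) hm₁0.le) (by positivity))
  -- floor at `t₀` (w3 g58)
  have hfloor' : m₁ ≤ (ringMeasure L).real {P | ringDeficit L (fun _ => false) P ≤ t₀} := by
    have h := exp_le_ringMeasure_real_deficit_le (L := L) ht₀0 ht₀1
    rw [ht₀, inv_inv] at h
    have e5 : ((L : ℕ) : ℝ) ^ (5 : ℝ) = (L : ℝ) ^ (5 : ℕ) := by exact_mod_cast Real.rpow_natCast (L : ℝ) 5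
    rw [hm₁, hB, e5, ht₀]
    exact h
  -- the robust law on `(0, t₀]` with exponent `α`, defect `η`
  have hscal' : ∀ t : ℝ, 0 < t → t ≤ t₀ → ∀ θ : ℝ, 0 < θ → θ ≤ 1 →
      (1 - η) * (θ ^ α * (ringMeasure L).real {P | ringDeficit L (fun _ => false) P ≤ t}) ≤
        (ringMeasure L).real {P | ringDeficit L (fun _ => false) P ≤ θ * t} := by
    intro t ht htt θ hθ0 hθ1
    have h := hsc L hL₂ t ht (htt.trans ht₀K) θ hθ0 hθ1
    rw [hη, hα]
    exact h
  -- the Tauberian bound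
  haveI := isProbabilityMeasure_ringMeasure (L := L)
  obtain ⟨hmeas, hnn, hder⟩ := deficitFormZero L
  have htaub := scalingTauber_robust (ringMeasure L) hmeas hnn hα1 ht₀0 hm₁0 (by positivity : 0 < c / 6) hη0 hη1 hβ0 hβt
    hfloor' hscal' hthr
  rw [hder β hβ0]
  -- `α + c/6 + η(1+α)/(1−η) ≤ 9L⁴ − c/2`
  have hextra : η * (1 + α) / (1 - η) ≤ 10 / 39 * c := by
    have h1η : 0 < 1 - η := by linarith
    rw [div_le_iff₀ h1η]
    have hnum : η * (1 + α) ≤ c / 4 := by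
      rw [hη, hα]
      have e : c / (40 * (L : ℝ) ^ 4) * (1 + (9 * (L : ℝ) ^ 4 - c)) ≤ c / (40 * (L : ℝ) ^ 4) * (10 * (L : ℝ) ^ 4) :=
        mul_le_mul_of_nonneg_left (by linarith) (by positivity)
      have e2 : c / (40 * (L : ℝ) ^ 4) * (10 * (L : ℝ) ^ 4) = c / 4 := by field_simp; ring
      linarith
    nlinarith
  have : α + c / 6 + η * (1 + α) / (1 - η) ≤ 9 * (L : ℝ) ^ 4 - c / 2 := by rw [hα]; linarith
  linarith

end Summit.QuantumFields.YangMills.Theorems.VirialFluxGap.VolumeScaling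

end
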